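import Literature.Barriers.ValiantsHypothesis.BIJL18Thm4VerifierSemantics
import Literature.Barriers.ValiantsHypothesis.BIJL18Thm4Machine
import Literature.Barriers.ValiantsHypothesis.BILPS19Cor42OfPIT
import Literature.Computability.AlgebraicComplexity.PITLanguageCoRP
import HarnessLib

/-!
# Bläser–Ikenmeyer–Jindal–Lysikov 2018, Thm 4 over fields of characteristic `0` (no `poly(n)`-natural
# proofs for border completion rank unless `coNP ⊆ ∃BPP`), REDUCED to a randomised identity test for
# integer circuits, and CLOSED by the tree's `PITLanguage ∈ BPP`

Theorem-only companion of `BIJL18MatrixCompletion.lean` (typed fact `BIJL2018_thm4 K`, ECCC TR18-064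
Thm 4, proof pp. 11–12: "(1) Guess a circuit `C` of polynomial size computing a polynomial `p`.
(2) Decide whether `p(g) = 0` using polynomial identity testing. (3) Check whether `p(T_φ) ≠ 0` …
It is obviously an `∃BPP` algorithm. Note that `p(T_φ) ≠ 0` can again be checked by polynomial
identity testing.") assembling the printed `∃BPP` verifier from its tree-resident pieces: the two
identity-test circuits of the verifier with their soundness / completeness at the level of guessed
blocks and the Max-2-SAT end (`BIJL18Thm4VerifierSemantics.lean`), their polynomial-time writers on
the code of a Max-2-SAT instance (`BIJL18Thm4Machine.lean`, x5 lineage), `P^{BPP} = BPP` for bounded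
adaptive reductions (`AdBPPSim.adLang_mem_BPP`), the class step `coNP ⊆ ∃·BPP ⟸ Lᶜ ∈ ∃·BPP` for an
NP-hard `L` (`PolyExistsBPPClosure.lean`) with `L = MAX2SAT` (`MAX2SAT_isNPHard`, Garey–Johnson–
Stockmeyer), and the packaging lemmas of the twin assembly for BILPS Cor 42
(`BILPS19Cor42OfPIT.lean`, reused by name).

* §1 the verifier language `∈ BPP` (two adaptive queries to a `BPP` identity test);
* §2 SOUNDNESS (an accepted pair has its instance outside `MAX2SAT`) and COMPLETENESS under the
  natural-proof hypothesis (an instance outside `MAX2SAT` has a short accepted witness), the witness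
  polynomial, `MAX2SATᶜ ∈ ∃·BPP`;
* §3 **`BIJL2018_thm4_of_randomizedPIT`**: for any `B ∈ BPP` agreeing with `PITLanguage` on circuit
  words `circuitWord m C` with `m ≤ |circuitWord m C|`, `BIJL2018_thm4 K` holds for every field `K`
  of characteristic `0`; **`BIJL2018_thm4_of_PIT_mem_BPP`**; and the closer
  **`BIJL2018_thm4_charZero : BIJL2018_thm4 K`** for `K` of characteristic `0`, from the tree's
  `PITLanguage_mem_BPP` (Schwartz 1980 / Ibarra–Moran 1983, `PITLanguageCoRP.lean`).

The typed fact `BIJL2018_thm4` is stated for every INFINITE field; this file discharges it for the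
fields of characteristic `0` ("One can think of `K = ℂ`", §2 of the source). Positive characteristic
needs an identity test modulo the characteristic over an infinite field and is NOT covered here.
DEVIATIONS from the printed proof, disclosed: the slice-rank profile of `g` is `r_k = n` (vacuous)
instead of `r_k = rk(A_k)` (the typed natural proofs vanish on all tensors of border completion rank
`≤ r`); instances below the size threshold `n₀` of the assumed natural proofs are padded by
tautological clauses (`padCNF`) instead of "let `n` be large enough"; the guessed circuit is a
Kabanets–Impagliazzo gate list. No new facts. HONEST FRAMING (val-lit): a 2018 CONDITIONAL barrier
about the varieties `{\underline{CR} ≤ r}` with a Boolean hypothesis, proved inside the tree for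
characteristic `0`; nothing here is about `VP`; `VP ≠ VNP` is NOT proved.

## References

* [BlaserIkenmeyerJindalLysikov2018] M. Bläser, C. Ikenmeyer, G. Jindal, V. Lysikov, *Generalized
  matrix completion and algebraic natural proofs*, STOC 2018 / ECCC TR18-064: Thm 4 (proof,
  ECCC pp. 11–12), Thm 3, Lemma 14, Lemma 16.
* [AroraBarak2009] S. Arora, B. Barak, *Computational Complexity: A Modern Approach*, CUP 2009,
  Def. 5.3 (∃·), §7.5.2 (`BPP^{BPP} = BPP`), Thm. 8.18 (proof).
* [GareyJohnsonStockmeyer1976] M. R. Garey, D. S. Johnson, L. Stockmeyer, TCS 1 (1976), Thm. 1.1.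
* [Schwartz1980] J. T. Schwartz, J. ACM 27 (1980); [IbarraMoran1983] O. Ibarra, S. Moran, J. ACM 30.
-/

noncomputable section

open MvPolynomial

namespace Literature.Barriers.ValiantsHypothesis

namespace BIJL2018Thm4

open Literature.Computability.AlgebraicComplexity Literature.Computability.Complexity ArithCircuit KIReduction
open _root_.Computability CodeFP Brick CNF MaxTwoSat BIJL18NPHard
open BILPS2019Cor42 (wordE evalCircuit decLang decLang_mem_P union_mem_BPP_of_mem_P_left size_le_length_circuitWord)
open scoped Literature.Computability.Complexity.Notation

universe u

/-! ### §1. The `∃·BPP` verifier: two adaptive queries to a randomised identity test -/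

section Verifier

open AdQuery

variable (n₀ : ℕ)

/-- The chart-test writer of `BIJL18Thm4Machine.lean` as a string function.
[cite: BlaserIkenmeyerJindalLysikov2018, Thm. 4 (proof, step (2))] -/
def chartFn : List Bool → List Bool := Classical.choose (exists_chartFn n₀)

/-- `chartFn ∈ FP`. [cite: AroraBarak2009, §1.3] -/
theorem chartFn_mem_FP : chartFn n₀ ∈ FP := (Classical.choose_spec (exists_chartFn n₀)).1

/-- Value of `chartFn` on an input pair. [cite: BlaserIkenmeyerJindalLysikov2018, Thm. 4 (proof, step (2))] -/
theorem chartFn_apply (w y : List Bool) : chartFn n₀ (boolPair w y) = wordE (chartInst n₀ (decInst w, y)) :=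
  (Classical.choose_spec (exists_chartFn n₀)).2 w y

/-- The evaluation writer as a string function. [cite: BlaserIkenmeyerJindalLysikov2018, Thm. 4 (proof, step (3))] -/
def evalFn : List Bool → List Bool := Classical.choose (exists_evalFn n₀)

/-- `evalFn ∈ FP`. [cite: AroraBarak2009, §1.3] -/
theorem evalFn_mem_FP : evalFn n₀ ∈ FP := (Classical.choose_spec (exists_evalFn n₀)).1

/-- Value of `evalFn` on an input pair. [cite: BlaserIkenmeyerJindalLysikov2018, Thm. 4 (proof, step (3))] -/
theorem evalFn_apply (w y : List Bool) : evalFn n₀ (boolPair w y) = wordE (evalInst n₀ (decInst w, y)) :=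
  (Classical.choose_spec (exists_evalFn n₀)).2 w y

/-- The main-case test (canonical code and `main`) as a string function. [cite: AroraBarak2009, §1.3] -/
def mainFn : List Bool → List Bool := Classical.choose exists_mainFn

/-- `mainFn ∈ FP`. [cite: AroraBarak2009, §1.3] -/
theorem mainFn_mem_FP : mainFn ∈ FP := (Classical.choose_spec exists_mainFn).1

/-- Value of `mainFn`. [cite: AroraBarak2009, §1.3] -/
theorem mainFn_apply (w y : List Bool) :
    mainFn (boolPair w y) = [decide (encodingCNFNat.encode (decInst w) = w) && main (decInst w)] :=
  (Classical.choose_spec exists_mainFn).2 w y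

/-- The easy-accept test as a string function. [cite: AroraBarak2009, §1.3] -/
def easyFn : List Bool → List Bool := Classical.choose exists_easyFn

/-- `easyFn ∈ FP`. [cite: AroraBarak2009, §1.3] -/
theorem easyFn_mem_FP : easyFn ∈ FP := (Classical.choose_spec exists_easyFn).1

/-- Value of `easyFn`. [cite: AroraBarak2009, §1.3] -/
theorem easyFn_apply (w y : List Bool) :
    easyFn (boolPair w y) = [!decide (encodingCNFNat.encode (decInst w) = w) || easy (decInst w)] :=
  (Classical.choose_spec exists_easyFn).2 w y

/-- **The query map**: first the chart-test word, then the evaluation word (one answer received).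
[cite: BlaserIkenmeyerJindalLysikov2018, Thm. 4 (proof, steps (2)–(3))] -/
theorem exists_queryFn : ∃ Q ∈ FP, ∀ z bits : List Bool,
    Q (boolPair z bits) = if bits.length = 0 then chartFn n₀ z else evalFn n₀ z := by
  have hc : CodeFP strE strE (chartFn n₀) := of_fn _ (chartFn_mem_FP n₀) fun _ => rfl
  have he : CodeFP strE strE (evalFn n₀) := of_fn _ (evalFn_mem_FP n₀) fun _ => rfl
  obtain ⟨Q, hQ, hQw⟩ := (natEq.comp ((strNatLength.comp (snd strE strE)).pair (const _ 0))).ite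
    (hc.comp (fst _ _)) (he.comp (fst _ _))
  refine ⟨Q, hQ, fun z bits => ?_⟩
  have h := hQw (z, bits)
  simp only [pairE_apply, decide_eq_true_eq] at h
  exact h

/-- The query map. [cite: BlaserIkenmeyerJindalLysikov2018, Thm. 4 (proof)] -/
def queryFn : List Bool → List Bool := Classical.choose (exists_queryFn n₀)

/-- `queryFn ∈ FP`. [cite: AroraBarak2009, §1.3] -/
theorem queryFn_mem_FP : queryFn n₀ ∈ FP := (Classical.choose_spec (exists_queryFn n₀)).1

/-- Value of the query map. [cite: BlaserIkenmeyerJindalLysikov2018, Thm. 4 (proof)] -/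
theorem queryFn_apply (z bits : List Bool) :
    queryFn n₀ (boolPair z bits) = if bits.length = 0 then chartFn n₀ z else evalFn n₀ z :=
  (Classical.choose_spec (exists_queryFn n₀)).2 z bits

variable (B : Language Bool)

/-- **The two-query language**: the bounded adaptive reduction asking `B` the chart-test word and
the evaluation word; accept iff the answers were (yes, no). [cite: BlaserIkenmeyerJindalLysikov2018, Thm. 4 (proof: "Decide whether p(g) = 0 … Check whether p(T_φ) ≠ 0. If yes, then accept")] -/
def twoQuery : Language Bool := adLang (queryFn n₀) (Polynomial.C 2) decLang B

/-- **`twoQuery ∈ BPP` for `B ∈ BPP`** (`P^{BPP} = BPP` for bounded adaptive reductions).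
[cite: AroraBarak2009, §7.5.2] -/
theorem twoQuery_mem_BPP (hB : B ∈ BPP) : twoQuery n₀ B ∈ BPP :=
  AdBPPSim.adLang_mem_BPP hB (queryFn_mem_FP n₀) _ decLang_mem_P

/-- **Membership in the two-query language**: the chart-test word is in `B` and the evaluation word
is not. [cite: BlaserIkenmeyerJindalLysikov2018, Thm. 4 (proof)] -/
theorem mem_twoQuery_iff (z : List Bool) : z ∈ twoQuery n₀ B ↔ chartFn n₀ z ∈ B ∧ evalFn n₀ z ∉ B := by
  rw [twoQuery, mem_adLang_iff, Polynomial.eval_C]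
  have h2 : adBits (queryFn n₀) B z 2 = [B.boolIndicator (chartFn n₀ z), B.boolIndicator (evalFn n₀ z)] := by
    rw [show (2 : ℕ) = 0 + 1 + 1 from rfl, adBits_succ, adBits_succ, adBits_zero, queryFn_apply, List.nil_append,
      queryFn_apply]
    simp
  rw [h2]
  change sndF (boolPair z [B.boolIndicator (chartFn n₀ z), B.boolIndicator (evalFn n₀ z)]) = [true, false] ↔ _
  have hc : chartFn n₀ z ∈ B ↔ Set.boolIndicator B (chartFn n₀ z) = true :=
    Set.mem_iff_boolIndicator (B : Set (List Bool)) _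
  have he : evalFn n₀ z ∈ B ↔ Set.boolIndicator B (evalFn n₀ z) = true :=
    Set.mem_iff_boolIndicator (B : Set (List Bool)) _
  rw [sndF_boolPair, hc, he]
  cases Set.boolIndicator B (chartFn n₀ z) <;> cases Set.boolIndicator B (evalFn n₀ z) <;> simp

/-- **The verifier language**: easy accept, or main case and the two queries succeed.
[cite: BlaserIkenmeyerJindalLysikov2018, Thm. 4 (proof)] -/
def verifier : Language Bool :=
  ({z | easyFn z = [true]} : Language Bool) ⊔ (({z | mainFn z = [true]} : Language Bool) ⊓ twoQuery n₀ B)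

/-- **The verifier language is in `BPP`** for `B ∈ BPP`. [cite: BlaserIkenmeyerJindalLysikov2018, Thm. 4 (proof: "It is obviously an ∃BPP algorithm")] -/
theorem verifier_mem_BPP (hB : B ∈ BPP) : verifier n₀ B ∈ BPP :=
  union_mem_BPP_of_mem_P_left (setOf_apply_eq_apply_mem_P easyFn_mem_FP (const_mem_FP [true]))
    (inter_mem_BPP_of_mem_P_left (setOf_apply_eq_apply_mem_P mainFn_mem_FP (const_mem_FP [true]))
      (twoQuery_mem_BPP n₀ B hB))

end Verifier

/-! ### §2. Correctness of the verifier and the `∃·BPP` presentation of the complement of Max-2-SAT -/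

section Correctness

/-- The chart-test word is long enough to host its variables (the ballast).
[cite: BlaserIkenmeyerJindalLysikov2018, Thm. 4 (proof)] -/
theorem nVar_le_length_circuitWord (n m r : ℕ) (Bk : KBlock) :
    nVar n m r ≤ (circuitWord (nVar n m r) (chartCircuit n m r Bk)).length :=
  le_trans (by rw [size_chartCircuit]; omega) (size_le_length_circuitWord _)

/-- **The two tests read as circuit values**: on the main branch, acceptance of the two queries by a
`B` agreeing with `PITLanguage` on circuit words means the chart-test circuit of the padded instance
computes `0` and its evaluation circuit does not.
[cite: BlaserIkenmeyerJindalLysikov2018, Thm. 4 (proof, steps (2)–(3))] -/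
theorem tests_iff {B : Language Bool}
    (hagree : ∀ (m : ℕ) (C : ArithCircuit ℤ (Fin m)), m ≤ (circuitWord m C).length → (circuitWord m C ∈ B ↔ C.eval = 0))
    (n₀ : ℕ) (φ : CNF ℕ) (b : ℕ) (y : List Bool) :
    (wordE (chartInst n₀ ((φ, b), y)) ∈ B ∧ wordE (evalInst n₀ ((φ, b), y)) ∉ B) ↔
      ((chartCircuit (nOf (padCNF n₀ φ)) (tOf (padCNF n₀ φ))
          (2 * (padCNF n₀ φ).length - (b + n₀)) (readBlock y)).eval = 0 ∧
        (evalCircuit (nPos (nOf (padCNF n₀ φ)) (tOf (padCNF n₀ φ)))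
          (entryFn (entries (padCNF n₀ φ))) (readBlock y)).eval ≠ 0) := by
  rw [wordE_chartInst, wordE_evalInst, hagree _ _ (nVar_le_length_circuitWord _ _ _ _), hagree _ _ (Nat.zero_le _)]
  rfl

variable {B : Language Bool}

/-- **SOUNDNESS of the verifier**: an accepted pair has its instance outside `MAX2SAT` (easy cases
by inspection; on the main branch by the block-level soundness of the two tests, Lemma 14 and the
padding). [cite: BlaserIkenmeyerJindalLysikov2018, Thm. 4 (proof: "The correctness follows from the construction")] -/
theorem not_mem_of_mem_verifier
    (hagree : ∀ (m : ℕ) (C : ArithCircuit ℤ (Fin m)), m ≤ (circuitWord m C).length → (circuitWord m C ∈ B ↔ C.eval = 0))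
    {n₀ : ℕ} {w y : List Bool} (h : boolPair w y ∈ verifier n₀ B) : w ∉ MAX2SAT := by
  rcases h with he | ⟨hm, hq⟩
  · have he' : easyFn (boolPair w y) = [true] := he
    rw [easyFn_apply] at he'
    simp only [List.cons.injEq, and_true, Bool.or_eq_true, Bool.not_eq_true', decide_eq_false_iff_not] at he'
    rcases he' with he' | he'
    · exact not_mem_MAX2SAT_of_not_canon he'
    · exact not_mem_MAX2SAT_of_easy he'
  · have hm' : mainFn (boolPair w y) = [true] := hm
    rw [mainFn_apply] at hm'
    simp only [List.cons.injEq, and_true, Bool.and_eq_true, decide_eq_true_eq] at hm'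
    obtain ⟨hcanon, hmain⟩ := hm'
    obtain ⟨h2, hb, -⟩ := (main_eq_true_iff _).1 hmain
    have hq' := (mem_twoQuery_iff n₀ B (boolPair w y)).1 hq
    rw [chartFn_apply, evalFn_apply] at hq'
    obtain ⟨hchart, heval⟩ := (tests_iff hagree n₀ (decInst w).1 (decInst w).2 y).1 hq'
    have hno := not_exists_numSatClauses_of_tests n₀ h2 (by omega) (readBlock y) hchart heval
    intro hw
    rw [← hcanon, mem_MAX2SAT_iff'] at hw
    exact hno hw.2

/-- The clause count is no longer than the instance code. [cite: AroraBarak2009, §0.1] -/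
theorem length_le_length_encode (p : CNF ℕ × ℕ) : p.1.length ≤ (encodingCNFNat.encode p).length := by
  rw [encodingCNFNat_eq]
  obtain ⟨φ, b⟩ := p
  simp only [pairE_apply, length_boolPair, cnfE, listE, length_unE]
  omega

/-- **The witness polynomial**: a bound on the code length of the guessed block, in the length `L` of
the instance code (`n = 2(|φ| + n₀) ≤ 2(L + n₀)`, `t = n + 1`, `|B| ≤ n^c₀ + c₀ + 1`).
[cite: BlaserIkenmeyerJindalLysikov2018, Thm. 4 (proof: "Guess a circuit C of polynomial size")] -/
def witnessPoly (c₀ n₀ : ℕ) : Polynomial ℕ :=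
  ((2 * (Polynomial.X + Polynomial.C n₀)) ^ c₀ + Polynomial.C c₀ + 1) *
    (6 * ((2 * (Polynomial.X + Polynomial.C n₀) + 2) * (2 * (Polynomial.X + Polynomial.C n₀)) ^ 2 +
      (2 * (Polynomial.X + Polynomial.C n₀)) ^ c₀ + Polynomial.C c₀ + 1) + 58)

/-- Evaluation of the witness polynomial. [folklore] -/
private theorem eval_witnessPoly (c₀ n₀ L : ℕ) : (witnessPoly c₀ n₀).eval L =
    ((2 * (L + n₀)) ^ c₀ + c₀ + 1) *
      (6 * ((2 * (L + n₀) + 2) * (2 * (L + n₀)) ^ 2 + (2 * (L + n₀)) ^ c₀ + c₀ + 1) + 58) := by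
  simp [witnessPoly]

/-- **COMPLETENESS of the verifier** under the natural-proof hypothesis (the negation of the
conclusion of `BIJL2018_thm4 K` for size exponent `c₀` and threshold `n₀`): an instance outside
`MAX2SAT` has a short accepted witness. [cite: BlaserIkenmeyerJindalLysikov2018, Thm. 4 (proof: "Such a polynomial is guaranteed to exist by assumption")] -/
theorem exists_mem_verifier (K : Type u) [Field K] [CharZero K]
    (hagree : ∀ (m : ℕ) (C : ArithCircuit ℤ (Fin m)), m ≤ (circuitWord m C).length → (circuitWord m C ∈ B ↔ C.eval = 0))
    {c₀ n₀ : ℕ}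
    (hnat : ∀ n : ℕ, n₀ ≤ n → ∀ (m : ℕ) (A₀ : Matrix (Fin n) (Fin n) K) (A : Fin m → Matrix (Fin n) (Fin n) K)
      (r : ℕ), (∀ v, tensorPoint K A₀ A v = 0 ∨ tensorPoint K A₀ A v = 1 ∨ tensorPoint K A₀ A v = -1) →
        r < borderCompletionRank A₀ A → ∃ p, IsBorderCRProof K A₀ A r (n ^ c₀ + c₀) p)
    {w : List Bool} (hw : w ∉ MAX2SAT) :
    ∃ y : List Bool, y.length ≤ (witnessPoly c₀ n₀).eval w.length ∧ boolPair w y ∈ verifier n₀ B := by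
  have heasy : easyFn (boolPair w []) = [true] → ∃ y : List Bool,
      y.length ≤ (witnessPoly c₀ n₀).eval w.length ∧ boolPair w y ∈ verifier n₀ B :=
    fun h => ⟨[], by simp, Or.inl h⟩
  by_cases hcanon : encodingCNFNat.encode (decInst w) = w
  swap
  · exact heasy (by rw [easyFn_apply]; simp [hcanon])
  cases hez : easy (decInst w)
  swap
  · exact heasy (by rw [easyFn_apply, hez]; simp)
  cases hmz : main (decInst w)
  · exact absurd (mem_MAX2SAT_of_not_easy_of_not_main hcanon hez hmz) hw
  obtain ⟨h2, hb, h1⟩ := (main_eq_true_iff _).1 hmz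
  have hno : ¬ ∃ σ : ℕ → Bool, (decInst w).2 ≤ (decInst w).1.numSatClauses σ := fun hex =>
    hw (by rw [← hcanon, mem_MAX2SAT_iff']; exact ⟨h2, hex⟩)
  obtain ⟨Bk, hBlen, hBidx, hchart, heval⟩ :=
    exists_block_of_not_exists_numSatClauses K hnat (n₀ := n₀) h2 (by omega) hno
  refine ⟨encBlock Bk, ?_, Or.inr ⟨?_, ?_⟩⟩
  · -- the witness is short
    refine (length_encBlock_le hBidx).trans ?_
    rw [eval_witnessPoly]
    have hL : (decInst w).1.length ≤ w.length := by
      have h := length_le_length_encode (decInst w)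
      rwa [hcanon] at h
    have hn : nOf (padCNF n₀ (decInst w).1) ≤ 2 * (w.length + n₀) := by
      rw [nOf, length_padCNF]; omega
    have h1 : Bk.length ≤ (2 * (w.length + n₀)) ^ c₀ + c₀ + 1 :=
      hBlen.trans (by have := Nat.pow_le_pow_left hn c₀; omega)
    have h2 : nPos (nOf (padCNF n₀ (decInst w).1)) (tOf (padCNF n₀ (decInst w).1)) ≤
        (2 * (w.length + n₀) + 2) * (2 * (w.length + n₀)) ^ 2 := by
      unfold nPos tOf
      have ht : 2 * (padCNF n₀ (decInst w).1).length + 1 + 1 ≤ 2 * (w.length + n₀) + 2 := by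
        rw [length_padCNF]; omega
      exact Nat.mul_le_mul ht (Nat.pow_le_pow_left hn 2)
    exact Nat.mul_le_mul h1 (by omega)
  · show mainFn (boolPair w (encBlock Bk)) = [true]
    rw [mainFn_apply, hcanon, hmz]
    simp
  · refine (mem_twoQuery_iff n₀ B _).2 ?_
    rw [chartFn_apply, evalFn_apply]
    refine (tests_iff hagree n₀ (decInst w).1 (decInst w).2 (encBlock Bk)).2 ?_
    simp only [readBlock_encBlock]
    exact ⟨hchart, heval⟩

/-- **The complement of `MAX2SAT` is in `∃·BPP`** under the natural-proof hypothesis and a `BPP`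
identity test for circuit words. [cite: BlaserIkenmeyerJindalLysikov2018, Thm. 4 (proof: "We want to check whether every assignment satisfies < b clauses of ϕ … It is obviously an ∃BPP algorithm")] -/
theorem compl_MAX2SAT_mem_polyExists_BPP (K : Type u) [Field K] [CharZero K] (hB : B ∈ BPP)
    (hagree : ∀ (m : ℕ) (C : ArithCircuit ℤ (Fin m)), m ≤ (circuitWord m C).length → (circuitWord m C ∈ B ↔ C.eval = 0))
    {c₀ n₀ : ℕ}
    (hnat : ∀ n : ℕ, n₀ ≤ n → ∀ (m : ℕ) (A₀ : Matrix (Fin n) (Fin n) K) (A : Fin m → Matrix (Fin n) (Fin n) K)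
      (r : ℕ), (∀ v, tensorPoint K A₀ A v = 0 ∨ tensorPoint K A₀ A v = 1 ∨ tensorPoint K A₀ A v = -1) →
        r < borderCompletionRank A₀ A → ∃ p, IsBorderCRProof K A₀ A r (n ^ c₀ + c₀) p) :
    MAX2SATᶜ ∈ polyExists BPP := by
  refine ⟨verifier n₀ B, verifier_mem_BPP n₀ B hB, witnessPoly c₀ n₀, fun w => ⟨fun hw => ?_, fun ⟨y, _, hy⟩ => ?_⟩⟩
  · exact exists_mem_verifier K hagree hnat hw
  · exact not_mem_of_mem_verifier hagree hy

end Correctness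

/-! ### §3. The edge: Thm 4 in characteristic `0` from a randomised identity test -/

section Edge

variable (K : Type u) [Field K] [CharZero K] [Infinite K]

/-- **BIJL Thm 4 (characteristic `0`) from a `BPP` identity test for integer circuit words**: if some
`B ∈ BPP` agrees with `PITLanguage` on every circuit word `circuitWord m C` with `m ≤ |circuitWord m C|`,
then "for infinitely many `n`, there is … a tensor `t` with coefficients in `{−1, 0, 1}`, and a value
`r` such that there is no algebraic `poly(n)`-natural proof for the fact that `\underline{CR}(t) > r`
unless `coNP ⊆ ∃BPP`" (as typed, `K` of characteristic `0`). Proof as printed: were there natural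
proofs from some size on, the verifier above puts `MAX2SATᶜ` in `∃·BPP`; Max-2-SAT is NP-hard
(the source problem of Thm 3), so `coNP ⊆ ∃·BPP`.
[cite: BlaserIkenmeyerJindalLysikov2018, Thm. 4 (proof)] -/
theorem BIJL2018_thm4_of_randomizedPIT {B : Language Bool} (hB : B ∈ BPP)
    (hagree : ∀ (m : ℕ) (C : ArithCircuit ℤ (Fin m)), m ≤ (circuitWord m C).length → (circuitWord m C ∈ B ↔ C.eval = 0)) :
    BIJL2018_thm4 K := by
  intro hco c₀ n₀
  by_contra h
  push Not at h
  refine hco (coNP_subset_polyExists_BPP_of_isNPHard_of_compl_mem MAX2SAT_isNPHard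
    (compl_MAX2SAT_mem_polyExists_BPP K hB hagree (c₀ := c₀) (n₀ := n₀) fun n hn m A₀ A r hsign hlt => ?_))
  exact h n hn m A₀ A r hsign hlt

/-- **BIJL Thm 4 (characteristic `0`) from `PIT ∈ BPP`** (the tree's `PITLanguage`: ACIT for
division-free integer circuits; classically in `coRP ⊆ BPP` by Schwartz–Zippel / Ibarra–Moran).
[cite: BlaserIkenmeyerJindalLysikov2018, Thm. 4] -/
theorem BIJL2018_thm4_of_PIT_mem_BPP (hPIT : PITLanguage ∈ BPP) : BIJL2018_thm4 K :=
  BIJL2018_thm4_of_randomizedPIT K hPIT fun m C _ => circuitWord_mem_PITLanguage m C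

/-- **BIJL 2018 Thm 4 holds over every field of characteristic `0`** (the typed fact
`BIJL2018_thm4 K`, discharged for `K` with `CharZero K`; positive characteristic is not covered).
[cite: BlaserIkenmeyerJindalLysikov2018, Thm. 4] [cite: Schwartz1980, Cor. 1] -/
theorem BIJL2018_thm4_charZero : BIJL2018_thm4 K :=
  BIJL2018_thm4_of_PIT_mem_BPP K PITLanguage_mem_BPP

end Edge

end BIJL2018Thm4

end Literature.Barriers.ValiantsHypothesis
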